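import Summits.KontsevichZagierPeriods.KontsevichZagierPeriods.Theorems.SoloInformedToricTermwise
import HarnessLib

/-!
# THEOREM ND for all numerators: `[[0,1]ⁿ, P/Q]` on the cube-nondegenerate toric sector

Solo programme `solo-KontsevichZagierPeriods-informed`, session s104.

`soloInformed_presentable_of_nondegenerate_rational`: let `Q ∈ ℚ[x₁, …, xₙ]` be cube-nondegenerate
and `P ∈ ℚ[x]` arbitrary, and let `r` be an `IntegralRep` on `[0,1]ⁿ` whose integrand is `P/Q` on
the open cube.  Then `of r` is presentable by cube integrals of germs holomorphic near the closed
cube, inside the KZ calculus (`k = 1`).  Proof: termwise integrability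
(`soloInformed_integrableOn_monomial_div`, via the Laurent integrability test on the toric charts)
makes every truncation `[(0,1)ⁿ, P_t/Q]` an `IntegralRep`; integrand additivity along `supp P`
reduces to the monomial pieces `[(0,1)ⁿ, c_a xᵃ/Q]`, each presentable by THEOREM ND.  This removes
the sign hypothesis of THEOREM ND⁺ (`soloInformed_presentable_of_nonneg_numerator`): the cube crux
`SoloInformedAyoubCubeResolutionCube` holds on the whole cube-nondegenerate toric sector
`{[[0,1]ⁿ, P/Q] : Q cube-nondegenerate}`.

References: J. Ayoub, EMS Newsl. 91 (2014) §2.2; A. G. Kouchnirenko, Invent. Math. 32 (1976) §1;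
A. N. Varchenko, Funct. Anal. Appl. 10 (1976).
-/

noncomputable section

open scoped BigOperators
open MeasureTheory Set
open Literature.NumberTheory.Transcendental Literature.NumberTheory.Transcendental.KZ
open Literature.ModelTheory.ExponentialFields (IsSemialgebraic)
open Literature.AlgebraicGeometry.Resolution

namespace Summit.KontsevichZagierPeriods.KontsevichZagierPeriods.Theorems

variable {n : ℕ}

/-- **THEOREM ND for all numerators.**  Let `P, Q ∈ ℚ[x₁, …, xₙ]` with `Q` cube-nondegenerate, and
let `r` be an `IntegralRep` on `[0,1]ⁿ` whose integrand is `P/Q` on the open cube.  Then `of r` is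
presentable: `k • of r − ∑ⱼ cⱼ • of ρⱼ ∈ KZ.relations` with `k ≠ 0` and cube integrals `ρⱼ` of real
parts of germs holomorphic near the closed cube. [this work] -/
theorem soloInformed_presentable_of_nondegenerate_rational (P Q : MvPolynomial (Fin n) ℚ)
    (hND : SoloInformedCubeNondegenerate Q) (r : IntegralRep n)
    (hr : r.domain = soloInformedCube n)
    (hri : EqOn r.integrand (fun x => MvPolynomial.aeval x P / MvPolynomial.aeval x Q)
      (soloInformedOpenCube n)) :
    of r ∈ soloInformedPresentable := by
  classical
  have hQ : ∀ x ∈ soloInformedOpenCube n, MvPolynomial.aeval x Q ≠ 0 := fun x hx =>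
    soloInformed_aeval_ne_zero_of_nondegenerate hND fun i => ⟨(hx i).1, (hx i).2.le⟩
  have hOsub : soloInformedOpenCube n ⊆ r.domain := hr ▸ soloInformedOpenCube_subset_cube n
  -- pass to the open cube
  set r₀ := r.restrict (soloInformedOpenCube n) (isSemialgebraic_soloInformedOpenCube n) hOsub
    with hr₀
  have h₀ : of r - of r₀ ∈ relations :=
    r.of_sub_of_restrict_mem_relations (isSemialgebraic_soloInformedOpenCube n) hOsub
      (by rw [hr]; exact soloInformed_volume_cube_diff_openCube n)
  have hint : IntegrableOn (fun x => MvPolynomial.aeval x P / MvPolynomial.aeval x Q)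
      (soloInformedOpenCube n) :=
    r₀.integrableOn.congr_fun (fun x hx => hri hx) r₀.measurableSet_domain_holds
  -- termwise integrability (Laurent test on the toric charts)
  have hterm : ∀ a ∈ P.support, IntegrableOn (fun x => (∏ j, x j ^ a j) / MvPolynomial.aeval x Q)
      (soloInformedOpenCube n) := fun a ha => soloInformed_integrableOn_monomial_div P Q hND hint ha
  -- the truncated representations `[(0,1)ⁿ, P_t/Q]`
  set ρ : Finset (Fin n →₀ ℕ) → IntegralRep n := fun t =>
    if ht : t ⊆ P.support then
      IntegralRep.ofRational (soloInformedOpenCube n) (soloInformedTrunc P t) Q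
        (isSemialgebraic_soloInformedOpenCube n) hQ
        (soloInformed_integrableOn_trunc_div_of_terms P Q t fun a ha => hterm a (ht ha))
    else r₀ with hρ
  have hρdom : ∀ t, (ρ t).domain = soloInformedOpenCube n := fun t => by
    by_cases ht : t ⊆ P.support
    · simp only [hρ, ht, dif_pos]; rfl
    · simp only [hρ, ht, dif_neg, not_false_eq_true]; rfl
  have hρi : ∀ t, t ⊆ P.support → ∀ x, (ρ t).integrand x =
      MvPolynomial.aeval x (soloInformedTrunc P t) / MvPolynomial.aeval x Q := fun t ht x => by
    simp only [hρ, ht, dif_pos]; rfl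
  -- integrand additivity along the support
  have hsplit : ∀ t, t ⊆ P.support → of (ρ t) - ∑ a ∈ t, of (ρ {a}) ∈ relations := by
    intro t
    induction t using Finset.induction_on with
    | empty =>
      intro _
      rw [Finset.sum_empty, sub_zero]
      exact of_mem_relations_of_eqOn_zero _ fun x _ => by
        rw [hρi ∅ (Finset.empty_subset _)]
        simp [soloInformedTrunc]
    | insert b t hb ih =>
      intro hbt
      have ht : t ⊆ P.support := (Finset.subset_insert b t).trans hbt
      have hb' : {b} ⊆ P.support :=
        Finset.singleton_subset_iff.2 (hbt (Finset.mem_insert_self b t))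
      have h1 : of (ρ (insert b t)) - of (ρ {b}) - of (ρ t) ∈ relations :=
        integrandAddRel_subset_relations ⟨n, ρ (insert b t), ρ {b}, ρ t,
          by rw [hρdom, hρdom], by rw [hρdom, hρdom], fun x _ => by
            rw [Pi.add_apply, hρi _ hbt, hρi _ hb', hρi _ ht, soloInformed_aeval_trunc,
              soloInformed_aeval_trunc, soloInformed_aeval_trunc, Finset.sum_insert hb,
              Finset.sum_singleton, add_div], rfl⟩
      rw [Finset.sum_insert hb]
      have : of (ρ (insert b t)) - (of (ρ {b}) + ∑ a ∈ t, of (ρ {a})) =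
          (of (ρ (insert b t)) - of (ρ {b}) - of (ρ t)) + (of (ρ t) - ∑ a ∈ t, of (ρ {a})) := by
        abel
      rw [this]
      exact relations.add_mem h1 (ih ht)
  -- `r₀` versus the full truncation
  have hfull : of r₀ - of (ρ P.support) ∈ relations :=
    of_sub_of_mem_relations_of_eqOn (by rw [hρdom]; rfl) fun x hx => by
      rw [hρi _ Subset.rfl]
      show r.integrand x = _
      rw [hri hx]
      unfold soloInformedTrunc
      rw [← MvPolynomial.as_sum P]
  -- each monomial piece by THEOREM ND
  have hpiece : ∀ a ∈ P.support, of (ρ {a}) ∈ soloInformedPresentable := by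
    intro a ha
    have hca : MvPolynomial.coeff a P ≠ 0 := MvPolynomial.mem_support_iff.1 ha
    have ha' : {a} ⊆ P.support := Finset.singleton_subset_iff.2 ha
    refine soloInformed_presentable_of_nondegenerate_of_subset a
      ((MvPolynomial.coeff a P)⁻¹ • Q) (soloInformed_cubeNondegenerate_smul hND (inv_ne_zero hca))
      (ρ {a}) (by rw [hρdom]) (by rw [hρdom]; exact soloInformedOpenCube_subset_cube n)
      fun x hx => ?_
    show _ = (∏ j, x j ^ a j) / MvPolynomial.aeval x ((MvPolynomial.coeff a P)⁻¹ • Q)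
    rw [hρi _ ha', soloInformed_aeval_trunc, Finset.sum_singleton, map_smul, Algebra.smul_def,
      eq_ratCast, eq_ratCast, Rat.cast_inv]
    have h1 : ((MvPolynomial.coeff a P : ℚ) : ℝ) ≠ 0 := by exact_mod_cast hca
    have h2 : MvPolynomial.aeval x Q ≠ 0 := hQ x hx
    field_simp
  -- assemble
  have hsum : ∑ a ∈ P.support, of (ρ {a}) ∈ soloInformedPresentable :=
    soloInformed_presentable_sum _ _ hpiece
  exact soloInformed_presentable_of_sub_mem h₀ (soloInformed_presentable_of_sub_mem hfull
    (soloInformed_presentable_of_sub_mem (hsplit _ Subset.rfl) hsum))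

/-- **THEOREM ND (all numerators) in the output format of the cube crux**
`SoloInformedAyoubCubeResolutionCube`: every rational integrand `P/Q` on `[0,1]ⁿ` with
cube-nondegenerate denominator admits an Ayoub cube resolution inside the KZ calculus. [this work] -/
theorem soloInformed_cubeResolution_nondegenerate_rational (P Q : MvPolynomial (Fin n) ℚ)
    (hND : SoloInformedCubeNondegenerate Q) (r : IntegralRep n)
    (hr : r.domain = soloInformedCube n)
    (hri : EqOn r.integrand (fun x => MvPolynomial.aeval x P / MvPolynomial.aeval x Q)
      (soloInformedOpenCube n)) :
    ∃ (k : ℕ) (_ : k ≠ 0) (m : ℕ) (d : Fin m → ℕ) (G : ∀ j, SoloInformedCubeGerm (d j))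
      (c : Fin m → ℤ) (ρ : ∀ j, IntegralRep (d j)),
      (∀ j, (ρ j).domain = soloInformedCube (d j)) ∧
      (∀ j, EqOn (ρ j).integrand (fun x => ((G j).g (soloInformedToC (d j) x)).re)
        (soloInformedCube (d j))) ∧
      k • of r - ∑ j, c j • of (ρ j) ∈ relations :=
  soloInformed_exists_fin_of_presentable
    (soloInformed_presentable_of_nondegenerate_rational P Q hND r hr hri)

/-- **Corollary: integrability splits termwise on the nondegenerate sector.**  For cube-nondegenerate
`Q`, `P/Q ∈ L¹((0,1)ⁿ)` iff `xᵃ/Q ∈ L¹((0,1)ⁿ)` for every `a ∈ supp P`. [this work] -/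
theorem soloInformed_integrableOn_div_iff_terms (P Q : MvPolynomial (Fin n) ℚ)
    (hND : SoloInformedCubeNondegenerate Q) :
    IntegrableOn (fun x => MvPolynomial.aeval x P / MvPolynomial.aeval x Q)
        (soloInformedOpenCube n) ↔
      ∀ a ∈ P.support, IntegrableOn (fun x => (∏ j, x j ^ a j) / MvPolynomial.aeval x Q)
        (soloInformedOpenCube n) := by
  refine ⟨fun h a ha => soloInformed_integrableOn_monomial_div P Q hND h ha, fun h => ?_⟩
  have h1 := soloInformed_integrableOn_trunc_div_of_terms P Q P.support h
  refine h1.congr_fun (fun x _ => ?_) (by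
    rw [soloInformedOpenCube_eq_pi]; exact MeasurableSet.univ_pi fun _ => measurableSet_Ioo)
  show MvPolynomial.aeval x (soloInformedTrunc P P.support) / _ = _
  unfold soloInformedTrunc
  rw [← MvPolynomial.as_sum P]

end Summit.KontsevichZagierPeriods.KontsevichZagierPeriods.Theorems
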